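import Mathlib
import Summits.Ventures.HodgeRepro.Tier4.Line1.RTFSetting
import Summits.Ventures.HodgeRepro.Tier4.Line4.TailAssembly

/-!
# Tier4/Line4/TailAssemblySupport — C-L4-TAIL's assembly with the lattice count ON THE SUPPORT of the level family
(t4-L3-p2 g3's precision S14963: the size `d` sees one archimedean place, so the count over ALL orbits is infinite;
the honest count is over the orbits the level family actually hits, uniformly in the level)

Blind re-derivation cell `pub-hodge-repro`, Tier 4 (README §9–§10), seat t4-L1-p4 (gen 4), LINE L4 cut (c)
C-L4-TAIL (lead R-11 / R-15).  Target tree path `lean/Summits/Ventures/HodgeRepro/Tier4/Line4/TailAssemblySupport.lean`.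
Imports this seat's TailAssembly (`summable_exp_of_count` — the layer-cake, repeated here with its explicit bound —
and `Setting.J_ne_zero_of_orbital_tail`).  0 print.

WHAT IS PROVED.  `sum_exp_le_of_count_layer` / `tsum_exp_le_of_count`: from a count `#{o : d o ≤ T} ≤ C′ e^{α T}` the profile
`e^{−β d}` (`β > α`, `β ≥ 0`) has every partial sum and its `tsum` `≤ C′ e^α (1 − e^{α−β})⁻¹` — the layer-cake with
the constant made explicit (it is needed UNIFORMLY in the level).  **`exists_tail_lt_of_support_count`**: the assembly
of `exists_tail_lt_of_decay'` with `hsum` replaced by the count ON THE SUPPORT, uniform in `N`: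
`hcount : ∀ N T, ∃ s : Finset ι, (∀ o, a N o ≠ 0 → d o ≤ T → o ∈ s) ∧ (s.card : ℝ) ≤ C′ e^{α T}` (the orbits the
level-`N` family hits below size `T`; on the instance the compact archimedean factors at `w ≠ w₀` bound the other
coordinates of the invariant and the level only thins the coset, so `C′` is level-independent); the proof runs the
layer-cake on the subtype `{o // a N o ≠ 0}`, extends by `0` (`summable_subtype_iff_indicator`, `tsum_subtype`) and
bounds the tail by `C e^{−δ g N} · C′ e^α (1 − e^{α−β})⁻¹ → 0`.  Then **`Setting.exists_J_ne_zero_of_support_count`**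
(`J (f N) ≠ 0` from some level on) — the shape of record for C-L4-TAIL's displays (S1) sparsity, (S2′) count on the
support, (S3) decay, (S4) main term, (S5) the `tsum` geometric side.  Nothing here says anything about the status of
the Hodge conjecture for CM abelian varieties, which is NOT proved (HC_CM is NOT proved by anyone in this repository).
-/

set_option autoImplicit false

noncomputable section

namespace Summit.Ventures.HodgeRepro.Tier4.Line4

open Filter Topology

section CountBound

variable {ι : Type}

/-- the layer-cake, finite-sum form with the explicit constant: every partial sum of `e^{−β d}` is
`≤ C′ e^α (1 − e^{α−β})⁻¹`. -/
theorem sum_exp_le_of_count_layer (d : ι → ℝ) (hd : ∀ o, 0 ≤ d o) {α β C' : ℝ} (hαβ : α < β) (hβ : 0 ≤ β)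
    (hC' : 0 ≤ C')
    (hcount : ∀ T : ℝ, ∃ s : Finset ι, (∀ o, d o ≤ T → o ∈ s) ∧ (s.card : ℝ) ≤ C' * Real.exp (α * T))
    (t : Finset ι) :
    ∑ o ∈ t, Real.exp (-(β * d o)) ≤ C' * Real.exp α * (1 - Real.exp (α - β))⁻¹ := by
  classical
  set r : ℝ := Real.exp (α - β) with hr
  have hr0 : 0 ≤ r := (Real.exp_pos _).le
  have hr1 : r < 1 := by
    rw [hr, Real.exp_lt_one_iff]
    linarith
  have hgeo : Summable fun j : ℕ => r ^ j := summable_geometric_of_lt_one hr0 hr1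
  have hlayer : ∀ j : ℕ, ∑ o ∈ t.filter (fun o => ⌊d o⌋₊ = j), Real.exp (-(β * d o)) ≤
      C' * Real.exp α * r ^ j := by
    intro j
    obtain ⟨s, hs, hcard⟩ := hcount ((j : ℝ) + 1)
    have hsub : t.filter (fun o => ⌊d o⌋₊ = j) ⊆ s := by
      intro o ho
      rw [Finset.mem_filter] at ho
      refine hs o ?_
      have := Nat.lt_floor_add_one (d o)
      rw [ho.2] at this
      exact this.le
    have hterm : ∀ o ∈ t.filter (fun o => ⌊d o⌋₊ = j), Real.exp (-(β * d o)) ≤ Real.exp (-(β * j)) := by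
      intro o ho
      rw [Finset.mem_filter] at ho
      rw [Real.exp_le_exp, neg_le_neg_iff]
      have h1 : (j : ℝ) ≤ d o := by
        rw [← ho.2]
        exact Nat.floor_le (hd o)
      exact mul_le_mul_of_nonneg_left h1 hβ
    calc ∑ o ∈ t.filter (fun o => ⌊d o⌋₊ = j), Real.exp (-(β * d o))
        ≤ (t.filter (fun o => ⌊d o⌋₊ = j)).card • Real.exp (-(β * j)) :=
          Finset.sum_le_card_nsmul _ _ _ hterm
      _ = ((t.filter (fun o => ⌊d o⌋₊ = j)).card : ℝ) * Real.exp (-(β * j)) := by rw [nsmul_eq_mul]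
      _ ≤ (C' * Real.exp (α * ((j : ℝ) + 1))) * Real.exp (-(β * j)) := by
          refine mul_le_mul_of_nonneg_right ?_ (Real.exp_pos _).le
          exact le_trans (by exact_mod_cast Finset.card_le_card hsub) hcard
      _ = C' * Real.exp α * r ^ j := by
          rw [hr, ← Real.exp_nat_mul, mul_assoc, ← Real.exp_add, mul_assoc, ← Real.exp_add]
          congr 2
          ring
  have hgroup : ∑ o ∈ t, Real.exp (-(β * d o)) =
      ∑ j ∈ t.image (fun o => ⌊d o⌋₊), ∑ o ∈ t.filter (fun o => ⌊d o⌋₊ = j), Real.exp (-(β * d o)) :=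
    (Finset.sum_fiberwise_of_maps_to (fun o ho => Finset.mem_image_of_mem _ ho) _).symm
  rw [hgroup]
  calc ∑ j ∈ t.image (fun o => ⌊d o⌋₊), ∑ o ∈ t.filter (fun o => ⌊d o⌋₊ = j), Real.exp (-(β * d o))
      ≤ ∑ j ∈ t.image (fun o => ⌊d o⌋₊), C' * Real.exp α * r ^ j :=
        Finset.sum_le_sum fun j _ => hlayer j
    _ = C' * Real.exp α * ∑ j ∈ t.image (fun o => ⌊d o⌋₊), r ^ j := by rw [Finset.mul_sum]
    _ ≤ C' * Real.exp α * ∑' j : ℕ, r ^ j := by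
        refine mul_le_mul_of_nonneg_left ?_ (by positivity)
        exact hgeo.sum_le_tsum _ (fun j _ => pow_nonneg hr0 j)
    _ = C' * Real.exp α * (1 - r)⁻¹ := by rw [tsum_geometric_of_lt_one hr0 hr1]

/-- the layer-cake with the explicit bound on the `tsum`. -/
theorem tsum_exp_le_of_count (d : ι → ℝ) (hd : ∀ o, 0 ≤ d o) {α β C' : ℝ} (hαβ : α < β) (hβ : 0 ≤ β)
    (hC' : 0 ≤ C')
    (hcount : ∀ T : ℝ, ∃ s : Finset ι, (∀ o, d o ≤ T → o ∈ s) ∧ (s.card : ℝ) ≤ C' * Real.exp (α * T)) :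
    (Summable fun o => Real.exp (-(β * d o))) ∧
      ∑' o, Real.exp (-(β * d o)) ≤ C' * Real.exp α * (1 - Real.exp (α - β))⁻¹ := by
  have hs : Summable fun o => Real.exp (-(β * d o)) :=
    summable_of_sum_le (c := C' * Real.exp α * (1 - Real.exp (α - β))⁻¹) (fun o => (Real.exp_pos _).le)
      (sum_exp_le_of_count_layer d hd hαβ hβ hC' hcount)
  exact ⟨hs, hs.tsum_le_of_sum_le (sum_exp_le_of_count_layer d hd hαβ hβ hC' hcount)⟩

end CountBound

section Support

variable {ι : Type}

/-- **C-L4-TAIL's assembly with the count ON THE SUPPORT of the level family, uniform in the level** (L3-p2's (S2′)):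
sparse off-`o₀` terms, decaying at rate `β + δ` in a size `d`, whose supports below size `T` have at most `C′ e^{α T}`
members (`α < β`, `β ≥ 0`, uniformly in `N`), are dominated by the `o₀`-term from some level on. -/
theorem exists_tail_lt_of_support_count (a : ℕ → ι → ℂ) (o₀ : ι) (d : ι → ℝ) (g : ℕ → ℝ) (hd : ∀ o, 0 ≤ d o)
    {C C' α β δ : ℝ} (hC : 0 ≤ C) (hC' : 0 ≤ C') (hαβ : α < β) (hβ : 0 ≤ β) (hδ : 0 < δ)
    (hg : Tendsto g atTop atTop)
    (hcount : ∀ (N : ℕ) (T : ℝ), ∃ s : Finset ι, (∀ o, a N o ≠ 0 → d o ≤ T → o ∈ s) ∧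
      (s.card : ℝ) ≤ C' * Real.exp (α * T))
    (hdecay : ∀ N o, o ≠ o₀ → ‖a N o‖ ≤ C * Real.exp (-((β + δ) * d o)))
    (hsparse : ∀ N o, o ≠ o₀ → a N o ≠ 0 → g N ≤ d o)
    (hmain : ∃ m : ℝ, 0 < m ∧ ∃ N₁ : ℕ, ∀ N ≥ N₁, m ≤ ‖a N o₀‖) :
    ∃ N₀ : ℕ, ∀ N ≥ N₀, a N o₀ ≠ 0 ∧ Summable (a N) ∧
      ‖∑' o : {o : ι // o ≠ o₀}, a N o.1‖ < ‖a N o₀‖ := by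
  classical
  obtain ⟨m, hm, N₁, hN₁⟩ := hmain
  set M : ℝ := C' * Real.exp α * (1 - Real.exp (α - β))⁻¹ with hMdef
  have hM0 : 0 ≤ M := by
    have : 0 ≤ (1 - Real.exp (α - β))⁻¹ := by
      refine inv_nonneg.2 ?_
      rw [sub_nonneg, Real.exp_le_one_iff]
      linarith
    positivity
  -- the profile on the support of `a N`, its summability and uniform bound
  have hprof : ∀ N : ℕ, (Summable fun o => ({o | a N o ≠ 0} : Set ι).indicator (fun o => Real.exp (-(β * d o))) o) ∧
      ∑' o, ({o | a N o ≠ 0} : Set ι).indicator (fun o => Real.exp (-(β * d o))) o ≤ M := by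
    intro N
    have hcount' : ∀ T : ℝ, ∃ s : Finset {o : ι // a N o ≠ 0},
        (∀ o : {o : ι // a N o ≠ 0}, d o.1 ≤ T → o ∈ s) ∧ (s.card : ℝ) ≤ C' * Real.exp (α * T) := by
      intro T
      obtain ⟨s, hs, hcard⟩ := hcount N T
      refine ⟨s.subtype (fun o => a N o ≠ 0), fun o ho => ?_, ?_⟩
      · rw [Finset.mem_subtype]
        exact hs o.1 o.2 ho
      · rw [Finset.card_subtype]
        exact le_trans (by exact_mod_cast Finset.card_filter_le _ _) hcard
    obtain ⟨hsum', hle'⟩ := tsum_exp_le_of_count (fun o : {o : ι // a N o ≠ 0} => d o.1) (fun o => hd o.1)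
      hαβ hβ hC' hcount'
    have hsum : Summable fun o => ({o | a N o ≠ 0} : Set ι).indicator (fun o => Real.exp (-(β * d o))) o :=
      summable_subtype_iff_indicator.1 hsum'
    refine ⟨hsum, ?_⟩
    rw [← tsum_subtype ({o | a N o ≠ 0} : Set ι) (fun o => Real.exp (-(β * d o)))]
    exact hle'
  -- the pointwise bound off `o₀` with the scale `g`
  have hpt0 : ∀ N : ℕ, ∀ o : ι, o ≠ o₀ → ‖a N o‖ ≤
      C * Real.exp (-(δ * g N)) * ({o | a N o ≠ 0} : Set ι).indicator (fun o => Real.exp (-(β * d o))) o := by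
    intro N o ho
    by_cases h0 : a N o = 0
    · rw [h0, norm_zero]
      exact mul_nonneg (by positivity) (Set.indicator_nonneg (fun _ _ => (Real.exp_pos _).le) _)
    · rw [Set.indicator_of_mem (show o ∈ ({o | a N o ≠ 0} : Set ι) from h0)]
      have hdo : g N ≤ d o := hsparse N o ho h0
      calc ‖a N o‖ ≤ C * Real.exp (-((β + δ) * d o)) := hdecay N o ho
        _ = C * (Real.exp (-(δ * d o)) * Real.exp (-(β * d o))) := by
            rw [← Real.exp_add]
            congr 2
            ring
        _ ≤ C * (Real.exp (-(δ * g N)) * Real.exp (-(β * d o))) := by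
            have hexp : Real.exp (-(δ * d o)) ≤ Real.exp (-(δ * g N)) := by
              rw [Real.exp_le_exp, neg_le_neg_iff]
              exact mul_le_mul_of_nonneg_left hdo hδ.le
            exact mul_le_mul_of_nonneg_left (mul_le_mul_of_nonneg_right hexp (Real.exp_pos _).le) hC
        _ = C * Real.exp (-(δ * g N)) * Real.exp (-(β * d o)) := by ring
  -- the tail bound for a fixed `N`
  have htail : ∀ N : ℕ, Summable (a N) ∧
      ‖∑' o : {o : ι // o ≠ o₀}, a N o.1‖ ≤ C * Real.exp (-(δ * g N)) * M := by
    intro N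
    obtain ⟨hsumN, hleN⟩ := hprof N
    have hpt : ∀ o : {o : ι // o ≠ o₀}, ‖a N o.1‖ ≤ C * Real.exp (-(δ * g N)) *
        ({o | a N o ≠ 0} : Set ι).indicator (fun o => Real.exp (-(β * d o))) o.1 :=
      fun o => hpt0 N o.1 o.2
    have hmaj : Summable fun o : {o : ι // o ≠ o₀} => C * Real.exp (-(δ * g N)) *
        ({o | a N o ≠ 0} : Set ι).indicator (fun o => Real.exp (-(β * d o))) o.1 :=
      (hsumN.subtype {o | o ≠ o₀}).mul_left _
    have hnorm : Summable fun o : {o : ι // o ≠ o₀} => ‖a N o.1‖ :=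
      Summable.of_nonneg_of_le (fun _ => norm_nonneg _) hpt hmaj
    have hsub : Summable fun o : {o : ι // o ≠ o₀} => a N o.1 := hnorm.of_norm
    have hall : Summable (a N) := (Set.finite_singleton o₀).summable_compl_iff.mp hsub
    refine ⟨hall, ?_⟩
    calc ‖∑' o : {o : ι // o ≠ o₀}, a N o.1‖
        ≤ ∑' o : {o : ι // o ≠ o₀}, ‖a N o.1‖ := norm_tsum_le_tsum_norm hnorm
      _ ≤ ∑' o : {o : ι // o ≠ o₀}, C * Real.exp (-(δ * g N)) *
            ({o | a N o ≠ 0} : Set ι).indicator (fun o => Real.exp (-(β * d o))) o.1 :=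
          hnorm.tsum_le_tsum hpt hmaj
      _ = C * Real.exp (-(δ * g N)) * ∑' o : {o : ι // o ≠ o₀},
            ({o | a N o ≠ 0} : Set ι).indicator (fun o => Real.exp (-(β * d o))) o.1 := tsum_mul_left
      _ ≤ C * Real.exp (-(δ * g N)) * M := by
          gcongr
          refine le_trans (Summable.tsum_subtype_le _ {o | o ≠ o₀}
            (fun _ => Set.indicator_nonneg (fun _ _ => (Real.exp_pos _).le) _) hsumN) hleN
  -- the bound tends to `0`
  have hlim : Tendsto (fun N : ℕ => C * Real.exp (-(δ * g N)) * M) atTop (𝓝 0) := by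
    have h1 : Tendsto (fun N : ℕ => -(δ * g N)) atTop atBot :=
      tendsto_neg_atTop_atBot.comp (hg.const_mul_atTop hδ)
    have h2 : Tendsto (fun N : ℕ => C * Real.exp (-(δ * g N)) * M) atTop (𝓝 (C * 0 * M)) :=
      ((Real.tendsto_exp_atBot.comp h1).const_mul C).mul_const M
    simpa using h2
  obtain ⟨N₂, hN₂⟩ := Filter.eventually_atTop.1 (hlim.eventually_lt_const hm)
  refine ⟨max N₁ N₂, fun N hN => ?_⟩
  have hN1 : N₁ ≤ N := le_trans (le_max_left _ _) hN
  have hN2 : N₂ ≤ N := le_trans (le_max_right _ _) hN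
  have hmN : m ≤ ‖a N o₀‖ := hN₁ N hN1
  refine ⟨fun h0 => ?_, (htail N).1, lt_of_le_of_lt (htail N).2 (lt_of_lt_of_le (hN₂ N hN2) hmN)⟩
  rw [h0, norm_zero] at hmN
  exact absurd hmN (not_le.2 hm)

end Support

section RTF

open Summit.Ventures.HodgeRepro.Tier4.Line1.RTF

variable {G : Type} [Group G] [TopologicalSpace G] [MeasurableSpace G] (S : Setting G)

/-- **C-L4-TAIL of record: `J (f N) ≠ 0` from some level on, with the count ON THE SUPPORT** — the displays (S1)
sparsity (`hsparse`, scale `g → ∞`), (S2′) count on the support uniform in the level (`hcount`), (S3) decay (`hdecay`),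
(S4) main term (`hmain`), (S5) the `tsum` geometric side (`hgeo`). -/
theorem Setting.exists_J_ne_zero_of_support_count (χ : S.T → ℂ) (χ' : S.T' → ℂ) (o₀ : S.Orbit) (f : ℕ → G → ℂ)
    (d : S.Orbit → ℝ) (g : ℕ → ℝ) (hd : ∀ o, 0 ≤ d o) {C C' α β δ : ℝ} (hC : 0 ≤ C) (hC' : 0 ≤ C')
    (hαβ : α < β) (hβ : 0 ≤ β) (hδ : 0 < δ) (hg : Tendsto g atTop atTop)
    (hcount : ∀ (N : ℕ) (T : ℝ), ∃ s : Finset S.Orbit,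
      (∀ o, S.orbital χ χ' o (f N) ≠ 0 → d o ≤ T → o ∈ s) ∧ (s.card : ℝ) ≤ C' * Real.exp (α * T))
    (hdecay : ∀ N o, o ≠ o₀ → ‖S.orbital χ χ' o (f N)‖ ≤ C * Real.exp (-((β + δ) * d o)))
    (hsparse : ∀ N o, o ≠ o₀ → S.orbital χ χ' o (f N) ≠ 0 → g N ≤ d o)
    (hmain : ∃ m : ℝ, 0 < m ∧ ∃ N₁ : ℕ, ∀ N ≥ N₁, m ≤ ‖S.orbital χ χ' o₀ (f N)‖)
    (hgeo : ∀ N, S.J χ χ' (f N) = ∑' o, S.orbital χ χ' o (f N)) :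
    ∃ N₀ : ℕ, ∀ N ≥ N₀, S.J χ χ' (f N) ≠ 0 := by
  obtain ⟨N₀, hN₀⟩ := exists_tail_lt_of_support_count (fun N o => S.orbital χ χ' o (f N)) o₀ d g hd hC hC' hαβ
    hβ hδ hg hcount hdecay hsparse hmain
  exact ⟨N₀, fun N hN => Setting.J_ne_zero_of_orbital_tail S χ χ' (hN₀ N hN).2.1 (hgeo N) (hN₀ N hN).2.2⟩

/-- **the same with the sparsity only from some level on** (plan-4's (S1) shape S14998: `2B < N → …`): the scale is
extended by `0` below `N₂` (`0 ≤ d`). -/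
theorem Setting.exists_J_ne_zero_of_support_count' (χ : S.T → ℂ) (χ' : S.T' → ℂ) (o₀ : S.Orbit) (f : ℕ → G → ℂ)
    (d : S.Orbit → ℝ) (g : ℕ → ℝ) (hd : ∀ o, 0 ≤ d o) {C C' α β δ : ℝ} (hC : 0 ≤ C) (hC' : 0 ≤ C')
    (hαβ : α < β) (hβ : 0 ≤ β) (hδ : 0 < δ) (hg : Tendsto g atTop atTop)
    (hcount : ∀ (N : ℕ) (T : ℝ), ∃ s : Finset S.Orbit,
      (∀ o, S.orbital χ χ' o (f N) ≠ 0 → d o ≤ T → o ∈ s) ∧ (s.card : ℝ) ≤ C' * Real.exp (α * T))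
    (hdecay : ∀ N o, o ≠ o₀ → ‖S.orbital χ χ' o (f N)‖ ≤ C * Real.exp (-((β + δ) * d o)))
    {N₂ : ℕ} (hsparse : ∀ N, N₂ < N → ∀ o, o ≠ o₀ → S.orbital χ χ' o (f N) ≠ 0 → g N ≤ d o)
    (hmain : ∃ m : ℝ, 0 < m ∧ ∃ N₁ : ℕ, ∀ N ≥ N₁, m ≤ ‖S.orbital χ χ' o₀ (f N)‖)
    (hgeo : ∀ N, S.J χ χ' (f N) = ∑' o, S.orbital χ χ' o (f N)) :
    ∃ N₀ : ℕ, ∀ N ≥ N₀, S.J χ χ' (f N) ≠ 0 := by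
  classical
  let g' : ℕ → ℝ := fun N => if N₂ < N then g N else 0
  have hg' : Tendsto g' atTop atTop := by
    refine hg.congr' ?_
    filter_upwards [Filter.eventually_gt_atTop N₂] with N hN
    simp only [g', if_pos hN]
  refine Setting.exists_J_ne_zero_of_support_count S χ χ' o₀ f d g' hd hC hC' hαβ hβ hδ hg' hcount hdecay
    (fun N o ho hne => ?_) hmain hgeo
  by_cases hN : N₂ < N
  · simp only [g', if_pos hN]
    exact hsparse N hN o ho hne
  · simp only [g', if_neg hN]
    exact hd o

end RTF

section Weighted

variable {ι : Type}

/-- **the assembly with a LEVEL WEIGHT on both sides** (the lead's (R-30) level-measure form, S15136/S15141): the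
off-`o₀` terms are bounded by `v N · C · e^{−(β+δ) d o}` and the `o₀`-term below by `m · v N` — the weight
`v N > 0` (the level measure `(μ_T ⊗ μ_{T′})(A_N)`, `≍ levelNorm N`) cancels, the count on the support / layer-cake /
margin are those of `exists_tail_lt_of_support_count` (applied to `a' N o := (v N)⁻¹ • a N o`). -/
theorem exists_tail_lt_of_support_count_weighted (a : ℕ → ι → ℂ) (o₀ : ι) (d : ι → ℝ) (g : ℕ → ℝ) (v : ℕ → ℝ)
    (hv : ∀ N, 0 < v N) (hd : ∀ o, 0 ≤ d o) {C C' α β δ : ℝ} (hC : 0 ≤ C) (hC' : 0 ≤ C') (hαβ : α < β)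
    (hβ : 0 ≤ β) (hδ : 0 < δ) (hg : Tendsto g atTop atTop)
    (hcount : ∀ (N : ℕ) (T : ℝ), ∃ s : Finset ι, (∀ o, a N o ≠ 0 → d o ≤ T → o ∈ s) ∧
      (s.card : ℝ) ≤ C' * Real.exp (α * T))
    (hdecay : ∀ N o, o ≠ o₀ → ‖a N o‖ ≤ v N * C * Real.exp (-((β + δ) * d o)))
    (hsparse : ∀ N o, o ≠ o₀ → a N o ≠ 0 → g N ≤ d o)
    (hmain : ∃ m : ℝ, 0 < m ∧ ∃ N₁ : ℕ, ∀ N ≥ N₁, m * v N ≤ ‖a N o₀‖) :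
    ∃ N₀ : ℕ, ∀ N ≥ N₀, a N o₀ ≠ 0 ∧ Summable (a N) ∧
      ‖∑' o : {o : ι // o ≠ o₀}, a N o.1‖ < ‖a N o₀‖ := by
  -- the rescaled family
  set a' : ℕ → ι → ℂ := fun N o => ((v N)⁻¹ : ℂ) * a N o with ha'
  have hvC : ∀ N, ((v N : ℂ)⁻¹) ≠ 0 := fun N => inv_ne_zero (by exact_mod_cast (hv N).ne')
  have hnorm' : ∀ N o, ‖a' N o‖ = (v N)⁻¹ * ‖a N o‖ := by
    intro N o
    simp only [a', norm_mul, norm_inv, Complex.norm_real, Real.norm_eq_abs, abs_of_pos (hv N)]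
  have hne' : ∀ N o, a' N o ≠ 0 ↔ a N o ≠ 0 := fun N o => by
    simp only [a', ne_eq, mul_eq_zero, hvC N, false_or]
  have hcount' : ∀ (N : ℕ) (T : ℝ), ∃ s : Finset ι, (∀ o, a' N o ≠ 0 → d o ≤ T → o ∈ s) ∧
      (s.card : ℝ) ≤ C' * Real.exp (α * T) := by
    intro N T
    obtain ⟨s, hs, hcard⟩ := hcount N T
    exact ⟨s, fun o ho hT => hs o ((hne' N o).1 ho) hT, hcard⟩
  have hdecay' : ∀ N o, o ≠ o₀ → ‖a' N o‖ ≤ C * Real.exp (-((β + δ) * d o)) := by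
    intro N o ho
    rw [hnorm', inv_mul_eq_div, div_le_iff₀ (hv N)]
    calc ‖a N o‖ ≤ v N * C * Real.exp (-((β + δ) * d o)) := hdecay N o ho
      _ = C * Real.exp (-((β + δ) * d o)) * v N := by ring
  have hsparse' : ∀ N o, o ≠ o₀ → a' N o ≠ 0 → g N ≤ d o :=
    fun N o ho hne => hsparse N o ho ((hne' N o).1 hne)
  have hmain' : ∃ m : ℝ, 0 < m ∧ ∃ N₁ : ℕ, ∀ N ≥ N₁, m ≤ ‖a' N o₀‖ := by
    obtain ⟨m, hm, N₁, hN₁⟩ := hmain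
    refine ⟨m, hm, N₁, fun N hN => ?_⟩
    rw [hnorm', inv_mul_eq_div, le_div_iff₀ (hv N)]
    exact hN₁ N hN
  obtain ⟨N₀, hN₀⟩ := exists_tail_lt_of_support_count a' o₀ d g hd hC hC' hαβ hβ hδ hg hcount' hdecay' hsparse'
    hmain'
  refine ⟨N₀, fun N hN => ⟨(hne' N o₀).1 (hN₀ N hN).1, ?_, ?_⟩⟩
  · have hs : Summable (a' N) := (hN₀ N hN).2.1
    have := hs.mul_left (v N : ℂ)
    refine this.congr fun o => ?_
    simp only [a']
    rw [← mul_assoc, mul_inv_cancel₀ (by exact_mod_cast (hv N).ne'), one_mul]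
  · have hlt := (hN₀ N hN).2.2
    have htsum : ∑' o : {o : ι // o ≠ o₀}, a' N o.1 = ((v N)⁻¹ : ℂ) * ∑' o : {o : ι // o ≠ o₀}, a N o.1 :=
      tsum_mul_left
    rw [htsum, norm_mul, norm_inv, Complex.norm_real, Real.norm_eq_abs, abs_of_pos (hv N), hnorm'] at hlt
    have hvpos : 0 < (v N)⁻¹ := inv_pos.2 (hv N)
    exact lt_of_mul_lt_mul_left hlt hvpos.le

end Weighted

end Summit.Ventures.HodgeRepro.Tier4.Line4

end
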